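import Literature.Analysis.FluidPDE.LongTimeAverageSlidingWindow
import Summits.AnomalousDissipation.AnomalousDissipation.Theorems.UniformRelaxationWitness.Negative.SeisTransfer
import Summits.AnomalousDissipation.AnomalousDissipation.Theorems.LimitingAbsorptionUniformRelaxationWitnessStubMeanEnergyGlue
import HarnessLib

/-!
# Negative knowledge for the crux `UniformRelaxationWitness` (stmt-AnomalousDissipation-2937), II:
# line `Sketch` — exact recurrent (time-periodic) states need unbounded per-period strain

The picked line `Cruxes/UniformRelaxationWitness/Lines/Sketch.lean` (card
`sign-coherent-two-phase-stirring`) closes the crux from ONE stub, `stub_recurrentSymmetricStates :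
RecurrentSymmetricStates` — exact `T_j`-periodic (`T_j ≤ T₀`), point-symmetric, steadily forced planar
Leray–Hopf states with POINTWISE energy `≤ E`, one-period relaxation of `h` and the absorbed-power floor.
This file records which hypotheses of that stub are load-bearing (refuter, cdisprove; supports
stmt-AnomalousDissipation-2937). All statements are NEGATIVE or non-Theses glue.

* `RecurrentStatesUnder Hyp` — the stub's class VERBATIM minus the two point-symmetry conjuncts (a
  weaker class, so every refutation here binds the stub), with an extra hypothesis `Hyp g h ν T v` that
  may see the periods `T`.
* `RecurrentStatesUnder.uniformRelaxationWitnessUnder` — the line's transfer, kept honest: periodic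
  phase reduction (one period of phases = all phases) and the pointwise-energy ⇒ `meanEnergy` glue
  (`stub_meanEnergyGlue`, landed) turn a recurrent state into an X-witness REMEMBERING its periodic data.
* `linearEnstrophyBudget_of_boundedPeriodStrain` — for `T_j`-periodic drifts with pointwise energy
  `≤ E` and `T_j ≤ T₀`, a `j`-uniform bound `S` on the PER-PERIOD MEAN STRAIN
  `T_j⁻¹ ∫₀^{T_j} ‖∇v_j‖_{L²}` is already a linear windowed enstrophy budget from phase `0` (slope
  `S (1 + T₀)`; periodicity sums the windows).
* `recurrentStates_false_without_unboundedPeriodStrain : ¬ RecurrentStatesUnder BoundedPeriodStrain` —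
  UNCONDITIONAL (Seis' floor via `uniformRelaxationWitness_false_without_superlinearEnstrophy`): the
  recurrent states of the line must have per-period mean strain `S_j → ∞` (by the sharp form of Seis'
  bound, `S_j ≳ γ log(1/ν_j)`) at pointwise energy `≤ E` and periods `≤ T₀` — the quantitative content
  of the card's "enstrophy `≍ log²(1/ν)`, Seis-sharp" bet, now a checked constraint on `stub_recurrentSymmetricStates`.
* `recurrentStates_false_without_superlinearEnstrophy`, `…_without_unboundedEnstrophy` — the general
  Seis floors restricted to the line's class.

## References

* C. Seis, Comm. Math. Phys. 399 (2023) 2071–2081 = arXiv:2003.08794, Thm. 2, Rmk. 1. [`Seis2022`]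
-/

noncomputable section

open MeasureTheory Set Filter Function TopologicalSpace Topology
open scoped ENNReal NNReal InnerProductSpace

namespace Summit.AnomalousDissipation.AnomalousDissipation.Theorems.UniformRelaxationWitness.Negative

-- D-0017: single-problem summit ⇒ `Summit.AnomalousDissipation.AnomalousDissipation.…` by design.
set_option linter.dupNamespace false

open Literature.Analysis.FunctionSpaces Literature.Analysis.FunctionSpaces.Torus
open Literature.Analysis.FluidPDE Literature.Analysis.FluidPDE.Torus
open Summit.AnomalousDissipation.AnomalousDissipation.Theses.LimitingAbsorption
open Summit.AnomalousDissipation.AnomalousDissipation.Theorems.RelaxingFamily.Negative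

/-- The unit flat 2-torus (local notation). -/
local notation "𝕋²" => UnitAddTorus (Fin 2)
/-- Planar vectors (local notation). -/
local notation "E²" => EuclideanSpace ℝ (Fin 2)

/-! ## The relaxation clause from a set of phases; periodic phase reduction -/

/-- The `(U_h)` clause with the admissible release phases restricted to `S ⊆ ℝ` (the line's
`RelaxesUniformlyFrom`, re-declared: crux workfiles are not importable). -/
def RelaxesUniformlyFrom (κ : ℝ) (u : ℝ → 𝕋² → E²) (h : 𝕋² → ℝ) (C γ : ℝ) (S : Set ℝ) : Prop :=
  ∀ s ∈ S, ∀ (T : ℝ) (θ : ℝ → 𝕋² → ℝ),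
    IsWeakScalarTransportOn T κ (fun t => u (s + t)) h θ →
      ∀ᵐ t ∂(volume.restrict (Ioo (0 : ℝ) T)),
        scalarL2Sq (θ t) ≤ C * Real.exp (-(γ * t)) * scalarL2Sq h

/-- **Periodic phase reduction** (the line's proved glue, re-proved here): for a `T₀`-periodic drift the
clause from the phases of one period `[0, T₀]` is the clause from every phase `s ≥ 0`, same constants
(the equation released at phase `s` is literally the one released at `s mod T₀`). [folklore] -/
theorem relaxesUniformlyFrom_Ici_of_periodic {κ : ℝ} {u : ℝ → 𝕋² → E²} {h : 𝕋² → ℝ} {C γ T₀ : ℝ}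
    (hT₀ : 0 < T₀) (hper : Function.Periodic u T₀)
    (hU : RelaxesUniformlyFrom κ u h C γ (Icc 0 T₀)) :
    RelaxesUniformlyFrom κ u h C γ (Ici 0) := by
  intro s _ T θ hθ
  set s' := toIcoMod hT₀ 0 s with hs'
  have hs'mem : s' ∈ Ico (0 : ℝ) (0 + T₀) := toIcoMod_mem_Ico hT₀ 0 s
  have hshift : (fun t => u (s + t)) = fun t => u (s' + t) := by
    funext t
    have h1 : s' = s - toIcoDiv hT₀ 0 s • T₀ := by rw [hs', self_sub_toIcoDiv_zsmul]
    rw [h1, zsmul_eq_mul]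
    have := (hper.int_mul (toIcoDiv hT₀ 0 s)).sub_eq (s + t)
    rw [show s - (toIcoDiv hT₀ 0 s : ℝ) * T₀ + t = s + t - (toIcoDiv hT₀ 0 s : ℝ) * T₀ by ring]
    exact this.symm
  have hs'Icc : s' ∈ Icc (0 : ℝ) T₀ := ⟨hs'mem.1, by simpa only [zero_add] using hs'mem.2.le⟩
  rw [hshift] at hθ
  exact hU s' hs'Icc T θ hθ

/-! ## The line's class with an extra hypothesis -/

/-- **The transfer class of line `Sketch` under an extra hypothesis.** Exact time-periodic steadily
forced planar Leray–Hopf states: steady smooth solenoidal mean-zero `g`, smooth mean-zero `h`,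
`ν_j → 0`, periods `0 < T_j ≤ T₀`, global Leray–Hopf `v_j` with `v_j(t + T_j) = v_j(t)`, local
boundedness, POINTWISE energy `∫‖v_j(t)‖² ≤ E` on `t ≥ 0`, the relaxation clause from the phases of one
period with `ν`-uniform `(C, γ)`, the absorption floor — the registered stub
`RecurrentSymmetricStates` of `Cruxes/UniformRelaxationWitness/Lines/Sketch.lean` with its two
point-symmetry conjuncts DROPPED (weaker class) — plus `Hyp g h ν T v`. -/
def RecurrentStatesUnder
    (Hyp : (𝕋² → E²) → (𝕋² → ℝ) → (ℕ → ℝ) → (ℕ → ℝ) → (ℕ → ℝ → 𝕋² → E²) → Prop) : Prop :=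
  ∃ (g : 𝕋² → E²) (h : 𝕋² → ℝ), IsSmooth g ∧ IsDivFree g ∧ HasZeroMean g ∧
    IsSmooth h ∧ HasZeroMean h ∧
    ∃ (ν T : ℕ → ℝ) (T₀ E : ℝ) (v₀ : ℕ → 𝕋² → E²) (v : ℕ → ℝ → 𝕋² → E²),
      (∀ j, 0 < ν j) ∧ Tendsto ν atTop (𝓝 0) ∧ (∀ j, 0 < T j ∧ T j ≤ T₀) ∧
      (∀ j, IsGlobalLerayHopf (ν j) (fun _ => g) (v₀ j) (v j)) ∧
      (∀ j (T' : ℝ), 0 < T' →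
        MemLp (stLift (v j)) ⊤ (volume.restrict (Ioo (0 : ℝ) T' ×ˢ univ))) ∧
      (∀ j, Function.Periodic (v j) (T j)) ∧
      (∀ j t, 0 ≤ t → ∫⁻ x, ‖v j t x‖ₑ ^ 2 ≤ ENNReal.ofReal E) ∧
      Hyp g h ν T v ∧
      (∃ C γ : ℝ, 0 ≤ C ∧ 0 < γ ∧ ∀ j, RelaxesUniformlyFrom (ν j) (v j) h C γ (Icc 0 (T j))) ∧
      ∃ ε : ℝ, 0 < ε ∧ ∀ j, ∃ θ : ℝ → 𝕋² → ℝ,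
        IsWeakScalarTransportForced (ν j) (v j) (fun _ => h) 0 θ ∧
        ε ≤ longTimeAvgSup (fun t => ν j * (eScalarGradNormSq (θ t)).toReal)

/-- The periodic data of a recurrent state, remembered as an extra hypothesis on the X-witness it yields. -/
def PeriodicData (Hyp : (𝕋² → E²) → (𝕋² → ℝ) → (ℕ → ℝ) → (ℕ → ℝ) → (ℕ → ℝ → 𝕋² → E²) → Prop)
    (g : 𝕋² → E²) (h : 𝕋² → ℝ) (ν : ℕ → ℝ) (v : ℕ → ℝ → 𝕋² → E²) : Prop :=
  ∃ (T : ℕ → ℝ) (T₀ E : ℝ), (∀ j, 0 < T j ∧ T j ≤ T₀) ∧ (∀ j, Function.Periodic (v j) (T j)) ∧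
    (∀ j t, 0 ≤ t → ∫⁻ x, ‖v j t x‖ₑ ^ 2 ≤ ENNReal.ofReal E) ∧ Hyp g h ν T v

/-- **The line's transfer, kept honest**: a recurrent state under `Hyp` is an X-witness under
`PeriodicData Hyp` (periodic phase reduction + `stub_meanEnergyGlue`). [folklore] -/
theorem RecurrentStatesUnder.uniformRelaxationWitnessUnder
    {Hyp : (𝕋² → E²) → (𝕋² → ℝ) → (ℕ → ℝ) → (ℕ → ℝ) → (ℕ → ℝ → 𝕋² → E²) → Prop}
    (hR : RecurrentStatesUnder Hyp) : UniformRelaxationWitnessUnder (PeriodicData Hyp) := by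
  obtain ⟨g, h, hg, hgd, hgm, hh, hhm, ν, T, T₀, E, v₀, v, hν, hνlim, hT, hLH, hbd, hper, hE, hH,
    ⟨C, γ, hC, hγ, hU⟩, hfloor⟩ := hR
  refine ⟨g, h, hg, hgd, hgm, hh, hhm, ν, v₀, v, hν, hνlim, hLH, hbd,
    ⟨max E 0, fun j =>
      Summit.AnomalousDissipation.AnomalousDissipation.Theorems.stub_meanEnergyGlue (v j) E (hE j)⟩,
    ⟨T, T₀, E, hT, hper, hE, hH⟩,
    ⟨C, γ, hC, hγ, fun j s hs T' θ hθ => ?_⟩, hfloor⟩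
  exact relaxesUniformlyFrom_Ici_of_periodic (hT j).1 (hper j) (hU j) s (mem_Ici.2 hs) T' θ hθ

/-! ## Periodic windows: a per-period strain bound is a linear budget -/

/-- Lower integral of a `P`-periodic function over `n` periods. [folklore] -/
theorem setLIntegral_Ioc_periodic (φ : ℝ → ℝ≥0∞) {P : ℝ} (hP : 0 < P) (hφ : Function.Periodic φ P)
    (n : ℕ) : ∫⁻ t in Ioc 0 ((n : ℝ) * P), φ t = n * ∫⁻ t in Ioc 0 P, φ t := by
  induction n with
  | zero => simp
  | succ n ih =>
    have hsplit : Ioc (0 : ℝ) (((n : ℝ) + 1) * P) = Ioc 0 ((n : ℝ) * P) ∪ Ioc ((n : ℝ) * P) ((n : ℝ) * P + P) := by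
      rw [Ioc_union_Ioc_eq_Ioc (by positivity) (by linarith), add_one_mul]
    have hdisj : Disjoint (Ioc (0 : ℝ) ((n : ℝ) * P)) (Ioc ((n : ℝ) * P) ((n : ℝ) * P + P)) :=
      disjoint_left.2 fun t ht ht' => (not_lt.2 ht.2) ht'.1
    have hshift : ∫⁻ t in Ioc ((n : ℝ) * P) ((n : ℝ) * P + P), φ t = ∫⁻ t in Ioc 0 P, φ t := by
      rw [setLIntegral_congr Ioo_ae_eq_Ioc.symm, setLIntegral_congr Ioo_ae_eq_Ioc.symm]
      have h1 := setLIntegral_Ioo_add_left φ 0 P ((n : ℝ) * P)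
      rw [add_zero] at h1
      rw [← h1]
      refine lintegral_congr fun t => ?_
      have := (hφ.nat_mul n) t
      rw [add_comm] at this
      exact this
    push_cast
    rw [hsplit, lintegral_union measurableSet_Ioc hdisj, ih, hshift, add_mul, one_mul]

/-- **Bounded per-period mean strain**: one `S ≥ 0` with `∫₀^{T_j} ‖∇v_j(τ)‖_{L²} dτ ≤ S T_j` for
every level (`‖∇w‖_{L²} = (eGradNormSq w)^{1/2}`). -/
def BoundedPeriodStrain (_g : 𝕋² → E²) (_h : 𝕋² → ℝ) (_ν : ℕ → ℝ) (T : ℕ → ℝ)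
    (v : ℕ → ℝ → 𝕋² → E²) : Prop :=
  ∃ S : ℝ, 0 ≤ S ∧ ∀ j, ∫⁻ τ in Ioo 0 (T j), eGradNormSq (v j τ) ^ (1 / 2 : ℝ) ≤ ENNReal.ofReal (S * T j)

/-- **For periodic drifts with pointwise energy `≤ E` and periods `≤ T₀`, a per-period strain bound
`S` is a linear windowed enstrophy budget from phase `0`** (slope `S (1 + T₀)`: a window `(0,t)` is
covered by `⌈t/T_j⌉ ≤ t/T_j + 1` periods). [folklore] -/
theorem linearEnstrophyBudget_of_boundedPeriodStrain {g : 𝕋² → E²} {h : 𝕋² → ℝ} {ν : ℕ → ℝ}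
    {v : ℕ → ℝ → 𝕋² → E²} (hP : PeriodicData BoundedPeriodStrain g h ν v) :
    LinearEnstrophyBudget g h ν v := by
  obtain ⟨T, T₀, E, hT, hper, hE, S, hS, hstrain⟩ := hP
  have hT₀ : 0 < T₀ := (hT 0).1.trans_le (hT 0).2
  refine ⟨S * (1 + T₀), by positivity, fun j => ⟨0, le_rfl, ⟨Real.toNNReal E, ?_⟩, fun t ht => ?_⟩⟩
  · filter_upwards [ae_restrict_mem measurableSet_Ioi] with t ht
    rw [zero_add]
    exact hE j t (le_of_lt ht)
  · obtain ⟨hTj, hTjT₀⟩ := hT j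
    set φ : ℝ → ℝ≥0∞ := fun τ => eGradNormSq (v j τ) ^ (1 / 2 : ℝ) with hφ
    have hφper : Function.Periodic φ (T j) := fun τ => by
      simp only [hφ, hper j τ]
    set n : ℕ := ⌈t / T j⌉₊ with hn
    have htn : t ≤ (n : ℝ) * T j := by
      have := Nat.le_ceil (t / T j)
      rw [div_le_iff₀ hTj] at this
      exact this
    have hn1 : (n : ℝ) ≤ t / T j + 1 := (Nat.ceil_lt_add_one (by positivity)).le
    calc ∫⁻ τ in Ioo 0 t, eGradNormSq (v j (0 + τ)) ^ (1 / 2 : ℝ)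
        = ∫⁻ τ in Ioo 0 t, φ τ := by simp only [zero_add, hφ]
      _ ≤ ∫⁻ τ in Ioc 0 ((n : ℝ) * T j), φ τ := lintegral_mono_set (Ioo_subset_Ioc_self.trans (Ioc_subset_Ioc_right htn))
      _ = n * ∫⁻ τ in Ioc 0 (T j), φ τ := setLIntegral_Ioc_periodic φ hTj hφper n
      _ = n * ∫⁻ τ in Ioo 0 (T j), φ τ := by rw [setLIntegral_congr Ioo_ae_eq_Ioc]
      _ ≤ n * ENNReal.ofReal (S * T j) := by gcongr; exact hstrain j
      _ = ENNReal.ofReal ((n : ℝ) * (S * T j)) := by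
          rw [ENNReal.ofReal_mul (Nat.cast_nonneg n), ENNReal.ofReal_natCast]
      _ ≤ ENNReal.ofReal (S * (1 + T₀) * (1 + t)) := by
          refine ENNReal.ofReal_le_ofReal ?_
          have h1 : (n : ℝ) * (S * T j) ≤ (t / T j + 1) * (S * T j) :=
            mul_le_mul_of_nonneg_right hn1 (by positivity)
          have h2 : (t / T j + 1) * (S * T j) = S * t + S * T j := by field_simp
          have h3 : S * T j ≤ S * T₀ := mul_le_mul_of_nonneg_left hTjT₀ hS
          nlinarith [mul_nonneg hS ht.le, mul_nonneg hS hT₀.le, mul_nonneg (mul_nonneg hS hT₀.le) ht.le]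

/-! ## The theorems -/

/-- **Recurrent states need unbounded per-period strain** (unconditional): no witness of the line's
class has `j`-uniformly bounded per-period mean strain `T_j⁻¹∫₀^{T_j}‖∇v_j‖_{L²} ≤ S`. Any proof of
`stub_recurrentSymmetricStates` must therefore exhibit exact periodic Navier–Stokes states with
per-period mean strain `→ ∞` along `ν_j → 0` (sharp Seis: `≳ γ log(1/ν_j)`) at pointwise energy `≤ E`
and periods `≤ T₀`. [cite: Seis2022, Thm 2 and Remark 1 (arXiv:2003.08794 pp. 3–4)] -/
theorem recurrentStates_false_without_unboundedPeriodStrain :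
    ¬ RecurrentStatesUnder BoundedPeriodStrain := fun hR =>
  uniformRelaxationWitness_false_without_superlinearEnstrophy
    (hR.uniformRelaxationWitnessUnder.mono fun _ _ _ _ => linearEnstrophyBudget_of_boundedPeriodStrain)

/-- **Recurrent states are subject to Seis' floor**: no witness of the line's class admits a
`j`-uniform linear windowed enstrophy budget from some phase on. [cite: Seis2022, Remark 1 (arXiv:2003.08794 p. 4)] -/
theorem recurrentStates_false_without_superlinearEnstrophy :
    ¬ RecurrentStatesUnder (fun g h ν _ v => LinearEnstrophyBudget g h ν v) := fun hR =>
  uniformRelaxationWitness_false_without_superlinearEnstrophy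
    (hR.uniformRelaxationWitnessUnder.mono fun _ _ _ _ ⟨_, _, _, _, _, _, hH⟩ => hH)

/-- **Recurrent states need unbounded enstrophy**: no witness of the line's class has `j`-uniformly
(essentially) bounded enstrophy from some phase on. [cite: Seis2022, Thm 2 (arXiv:2003.08794 pp. 3–4)] -/
theorem recurrentStates_false_without_unboundedEnstrophy :
    ¬ RecurrentStatesUnder (fun g h ν _ v => BoundedEnstrophy g h ν v) := fun hR =>
  uniformRelaxationWitness_false_without_unboundedEnstrophy
    (hR.uniformRelaxationWitnessUnder.mono fun _ _ _ _ ⟨_, _, _, _, _, _, hH⟩ => hH)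

end Summit.AnomalousDissipation.AnomalousDissipation.Theorems.UniformRelaxationWitness.Negative

end
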